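import Literature.NumberTheory.QuadraticFields.EffectiveClassNumberLowerBound
import Literature.NumberTheory.QuadraticFields.AmbiguousClasses
import Literature.NumberTheory.EllipticCurves.HeegnerPointsImaginaryQuadraticProofs
import Mathlib.Analysis.SpecialFunctions.Pow.Real
import Mathlib.Analysis.SpecialFunctions.Log.Basic
import HarnessLib

/-!
# Gross–Zagier 1986, Theorem (8.1) from Oesterlé's Théorème 1 and genus theory (PROVED)

Topic `NumberTheory/QuadraticFields`; proof companion of `EffectiveClassNumberLowerBound.lean`
(seat `rh-explicit-goldfeld-lit`). Everything here is PROVED (theorems only, no named facts).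

**Gross–Zagier 1986** [GrossZagier1986], Invent. Math. 84, §I.8, p. 232:
"(8.1) **Theorem.** For any `ε > 0` there is an effectively computable constant `κ(ε) > 0` such
that `h(D) > κ(ε)(log |D|)^{1−ε}`." Printed deduction (ibid., ll. 6–12): Oesterlé's sharper
inequality "(8.2) `C(t) h(D) > log |D|`, where `C(t)` is an explicitly given function of `t`, the
number of prime divisors of `D` … This implies Theorem (8.1) since `2^{t−1}` divides `h(D)` by
genus theory and hence `log C(t)` [is small compared with] `log h(D)`."

We formalize exactly this deduction, with Oesterlé's Théorème 1 (tree fact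
`Oesterle1985_theoreme1`: `θ(d) log d ≤ C h(−d)`, `θ(d) = ∏_{p ∈ P(d)} (1 − [2√p]/(p+1))`) as the
hypothesis and the tree's genus theorem `Quadratic.card_sq_eq_one_classGroup`
(`|Cl_K[2]| = 2^{t−1}`, `AmbiguousClasses.lean`) supplying `2^{t−1} ≤ h`:

* `one_div_succ_le_thetaFactor`, `one_sub_two_div_sqrt_le_thetaFactor` — the factor
  `1 − [2√p]/(p+1)` is `≥ 1/(p+1)` and `≥ 1 − 2/√p` (`p` prime);
* `oesterleTheta_ge` — for every `T ≥ 16`: `θ(d) ≥ T^{−T} · (1 − 2/√T)^{#P(d)}`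
  (split `P(d)` at `T`: at most `T` primes below `T`, each factor `≥ 1/T`; the others `≥ 1 − 2/√T`);
* `two_pow_le_classNumber` — genus theory: `2^{t−1} ≤ h_K`, `t = ω(|d_K|)`, for imaginary
  quadratic `K`;
* `two_pow_dvd_classNumber`, `quarter_le_thetaFactor`, `log_le_of_oesterle` — Oesterlé's p. 311
  corollaries of Théorème 1 (`h` odd `⇒ log d ≤ C h`; `h ≡ 2 (mod 4) ⇒ log d ≤ 4 C h`), from genus
  theory in divisibility form `2^{t−1} ∣ h` and the factor bound `≥ 1/4`;
* `third_le_thetaFactor`, `oesterleTheta_ge_two_adic`, `log_le_of_oesterle_two_adic` — the next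
  printed lines (`h ≡ 4 (mod 8) ⇒ log d ≤ 12 C h`; `h ≡ 8 (mod 16) ⇒ log d ≤ 36 C h`) and the general
  form `2^{k+1} ∤ h ⇒ log d ≤ (4/3)·3^k·C·h`, from `θ(d) ≥ (3/4)·3^{−(t−1)}`;
* `classNumber_gt_of_oesterle` — **(8.1)**: from `Oesterle1985_theoreme1`, for every `ε > 0`
  there is `κ > 0` with `κ (log |d_K|)^{1−ε} < h_K` for every imaginary quadratic field `K`
  (`finrank ℚ K = 2`, `d_K < 0`). The constant is `κ = ½ min(1, (C T^T)^{−1})` with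
  `T = ⌈16/(ε′ log 2)²⌉ + 16`, `ε′ = min(ε, ½)` — explicit in `C`, so "effectively computable"
  is inherited from Oesterlé's `C` (as printed).

Mechanism (as printed, quantified): with `r = 1 − 2/√T` and `λ = log(1/r)/log 2` one has
`r^{#P(d)} ≥ r^{t−1} ≥ h^{−λ}` (because `2^{t−1} ≤ h`), so `log d ≤ C h/θ(d) ≤ C T^T h^{1+λ}`;
`λ ≤ ε′` once `4/√T ≤ ε′ log 2`, and `(log d)^{1/(1+λ)} ≥ (log d)^{1−ε}` as `log d ≥ log 3 > 1`.

## References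

* [GrossZagier1986] B. H. Gross, D. B. Zagier, *Heegner points and derivatives of `L`-series*,
  Invent. Math. 84 (1986), §I.8, Thm. (8.1) and (8.2), p. 232.
* [Oesterle1985] J. Oesterlé, Sém. Bourbaki exp. 631, Astérisque 121–122 (1985), Thm. 1 (p. 310)
  and p. 311 (genus-theory corollaries).
* [Cox2013] D. A. Cox, *Primes of the form x² + ny²*, 2nd ed., Prop. 3.11 / Thm. 3.15 (genus theory).
-/

noncomputable section

open scoped Classical

open Real Finset NumberField Module

namespace Literature.NumberTheory.QuadraticFields

/-! ### The factors of `θ(d)` -/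

/-- For a prime `p`, `[2√p] = Nat.sqrt (4p) ≤ p` (as `4p < (p+1)²`). [folklore] -/
private theorem sqrt_four_mul_le {p : ℕ} (hp : p.Prime) : Nat.sqrt (4 * p) ≤ p := by
  have h2 : 2 ≤ p := hp.two_le
  have hlt : Nat.sqrt (4 * p) < p + 1 := by
    rw [Nat.sqrt_lt]
    nlinarith
  omega

/-- Each factor of `θ(d)` satisfies `1 − [2√p]/(p+1) ≥ 1/(p+1)` (`p` prime). (Oesterlé 1985,
p. 311, prints the exact values `1/3, 1/4, 1/3, 3/8` for `p = 2, 3, 5, 7`.) [cite: Oesterle1985, p. 311] -/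
theorem one_div_succ_le_thetaFactor {p : ℕ} (hp : p.Prime) :
    1 / ((p : ℝ) + 1) ≤ 1 - (Nat.sqrt (4 * p) : ℝ) / ((p : ℝ) + 1) := by
  have hs : (Nat.sqrt (4 * p) : ℝ) ≤ (p : ℝ) := by exact_mod_cast sqrt_four_mul_le hp
  have hpos : (0 : ℝ) < (p : ℝ) + 1 := by positivity
  rw [div_le_iff₀ hpos, sub_mul, div_mul_cancel₀ _ hpos.ne', one_mul]
  linarith

/-- Each factor of `θ(d)` satisfies `1 − [2√p]/(p+1) ≥ 1 − 2/√p` (`p` prime), since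
`[2√p] ≤ 2√p` and `p + 1 ≥ p = √p · √p`. (Oesterlé 1985, p. 311: "`1 − [2√p]/(p+1) ≥ 1/2` pour
`p ≥ 11`".) [cite: Oesterle1985, p. 311] -/
theorem one_sub_two_div_sqrt_le_thetaFactor {p : ℕ} (hp : p.Prime) :
    1 - 2 / Real.sqrt p ≤ 1 - (Nat.sqrt (4 * p) : ℝ) / ((p : ℝ) + 1) := by
  have hp0 : (0 : ℝ) < p := by exact_mod_cast hp.pos
  have hsq : 0 < Real.sqrt p := Real.sqrt_pos.mpr hp0
  have hpos : (0 : ℝ) < (p : ℝ) + 1 := by positivity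
  -- `Nat.sqrt (4p) ≤ 2 √p`
  have hs : (Nat.sqrt (4 * p) : ℝ) ≤ 2 * Real.sqrt p := by
    have hsq' : ((Nat.sqrt (4 * p) : ℕ) : ℝ) ^ 2 ≤ 4 * (p : ℝ) := by
      exact_mod_cast (by simpa [pow_two] using Nat.sqrt_le' (4 * p) : (Nat.sqrt (4 * p)) ^ 2 ≤ 4 * p)
    have h2 : (2 * Real.sqrt p) ^ 2 = 4 * (p : ℝ) := by
      rw [mul_pow, Real.sq_sqrt hp0.le]; norm_num
    have hnn : (0 : ℝ) ≤ 2 * Real.sqrt p := by positivity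
    nlinarith [sq_nonneg ((Nat.sqrt (4 * p) : ℝ) - 2 * Real.sqrt p), hsq', h2, hnn,
      Nat.cast_nonneg (α := ℝ) (Nat.sqrt (4 * p))]
  -- `2 √p / (p + 1) ≤ 2 / √p`
  have hkey : (Nat.sqrt (4 * p) : ℝ) / ((p : ℝ) + 1) ≤ 2 / Real.sqrt p := by
    rw [div_le_div_iff₀ hpos hsq]
    have hpp : Real.sqrt p * Real.sqrt p = p := Real.mul_self_sqrt hp0.le
    nlinarith [hs, hsq, hpp]
  linarith

/-! ### A lower bound for `θ(d)` in terms of the number of prime factors -/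

/-- `#P(d) ≤ t − 1`, where `P(d)` is Oesterlé's set of prime divisors of `d` minus the largest (the
index set of `θ(d)`; Oesterlé 1985 p. 310) and `t = ω(d)`. [cite: Oesterle1985, p. 310 (definition of `P(d)`)] -/
theorem card_primeFactors_erase_sup_le (d : ℕ) :
    (d.primeFactors.erase (d.primeFactors.sup id)).card ≤ d.primeFactors.card - 1 := by
  by_cases hne : d.primeFactors.Nonempty
  · obtain ⟨q, hq, hsup⟩ := Finset.exists_mem_eq_sup d.primeFactors hne id
    simp only [hsup, id, Finset.card_erase_of_mem hq, le_refl]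
  · rw [Finset.not_nonempty_iff_eq_empty] at hne
    simp [hne]

/-- **Lower bound for `θ(d)`.** For every natural `T ≥ 16`:
`θ(d) ≥ (1/T)^T · (1 − 2/√T)^{#P(d)}` — the primes of `P(d)` below `T` are at most `T` in number
and each contributes `≥ 1/(p+1) ≥ 1/T`; each prime `≥ T` contributes `≥ 1 − 2/√p ≥ 1 − 2/√T`.
(This quantifies Gross–Zagier's "`log C(t)`" growth, p. 232.) [cite: GrossZagier1986, §I.8 (8.2), p. 232] -/
theorem oesterleTheta_ge (d : ℕ) {T : ℕ} (hT : 16 ≤ T) :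
    (1 / (T : ℝ)) ^ T * (1 - 2 / Real.sqrt T) ^ (d.primeFactors.erase (d.primeFactors.sup id)).card ≤ oesterleTheta d := by
  have hT0 : (0 : ℝ) < T := by exact_mod_cast (show 0 < T by omega)
  have hsqT : 4 ≤ Real.sqrt T := by
    rw [show (4 : ℝ) = Real.sqrt 16 by rw [show (16 : ℝ) = 4 ^ 2 by norm_num, Real.sqrt_sq (by norm_num)]]
    exact Real.sqrt_le_sqrt (by exact_mod_cast hT)
  have hr0 : (0 : ℝ) ≤ 1 - 2 / Real.sqrt T := by
    rw [sub_nonneg, div_le_one (by linarith)]; linarith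
  have hr1 : 1 - 2 / Real.sqrt T ≤ 1 := by
    have : 0 ≤ 2 / Real.sqrt T := by positivity
    linarith
  have hinvT0 : (0 : ℝ) ≤ 1 / (T : ℝ) := by positivity
  have hinvT1 : 1 / (T : ℝ) ≤ 1 := by
    rw [div_le_one hT0]; exact_mod_cast (show 1 ≤ T by omega)
  -- pointwise lower bound by the step function
  set f : ℕ → ℝ := fun p => if p < T then 1 / (T : ℝ) else 1 - 2 / Real.sqrt T with hf
  have hpt : ∀ p ∈ d.primeFactors.erase (d.primeFactors.sup id), f p ≤ 1 - (Nat.sqrt (4 * p) : ℝ) / ((p : ℝ) + 1) := by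
    intro p hp
    have hprime : p.Prime := Nat.prime_of_mem_primeFactors (Finset.mem_of_mem_erase hp)
    by_cases hpT : p < T
    · simp only [hf, hpT, if_true]
      refine le_trans ?_ (one_div_succ_le_thetaFactor hprime)
      apply one_div_le_one_div_of_le (by positivity)
      have : (p : ℝ) + 1 ≤ T := by exact_mod_cast hpT
      exact this
    · simp only [hf, hpT, if_false]
      refine le_trans ?_ (one_sub_two_div_sqrt_le_thetaFactor hprime)
      have hTp : (T : ℝ) ≤ p := by exact_mod_cast (not_lt.mp hpT)
      have hsqp : Real.sqrt T ≤ Real.sqrt p := Real.sqrt_le_sqrt hTp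
      have : 2 / Real.sqrt p ≤ 2 / Real.sqrt T :=
        div_le_div_of_nonneg_left (by norm_num) (by linarith) hsqp
      linarith
  have hfnn : ∀ p ∈ d.primeFactors.erase (d.primeFactors.sup id), 0 ≤ f p := by
    intro p _
    by_cases hpT : p < T
    · simp only [hf, hpT, if_true]; exact hinvT0
    · simp only [hf, hpT, if_false]; exact hr0
  -- the product of the step function
  have hprod : ∏ p ∈ d.primeFactors.erase (d.primeFactors.sup id), f p =
      (1 / (T : ℝ)) ^ ((d.primeFactors.erase (d.primeFactors.sup id)).filter (· < T)).card *
        (1 - 2 / Real.sqrt T) ^ ((d.primeFactors.erase (d.primeFactors.sup id)).filter (fun p => ¬ p < T)).card := by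
    rw [hf, Finset.prod_ite, Finset.prod_const, Finset.prod_const]
  have hcard1 : ((d.primeFactors.erase (d.primeFactors.sup id)).filter (· < T)).card ≤ T := by
    calc ((d.primeFactors.erase (d.primeFactors.sup id)).filter (· < T)).card ≤ (Finset.range T).card :=
          Finset.card_le_card (fun p hp => by
            simp only [Finset.mem_filter] at hp; exact Finset.mem_range.mpr hp.2)
      _ = T := Finset.card_range T
  have hcard2 : ((d.primeFactors.erase (d.primeFactors.sup id)).filter (fun p => ¬ p < T)).card ≤ (d.primeFactors.erase (d.primeFactors.sup id)).card :=
    Finset.card_filter_le _ _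
  calc (1 / (T : ℝ)) ^ T * (1 - 2 / Real.sqrt T) ^ (d.primeFactors.erase (d.primeFactors.sup id)).card
      ≤ (1 / (T : ℝ)) ^ ((d.primeFactors.erase (d.primeFactors.sup id)).filter (· < T)).card *
          (1 - 2 / Real.sqrt T) ^ ((d.primeFactors.erase (d.primeFactors.sup id)).filter (fun p => ¬ p < T)).card := by
        apply mul_le_mul (pow_le_pow_of_le_one hinvT0 hinvT1 hcard1)
          (pow_le_pow_of_le_one hr0 hr1 hcard2) (pow_nonneg hr0 _) (pow_nonneg hinvT0 _)
    _ = ∏ p ∈ d.primeFactors.erase (d.primeFactors.sup id), f p := hprod.symm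
    _ ≤ oesterleTheta d := by
        unfold oesterleTheta
        exact Finset.prod_le_prod hfnn hpt

/-! ### Genus theory input: `2^{t−1} ≤ h` -/

/-- **Genus theory:** `2^{t−1} ≤ h_K` for an imaginary quadratic field `K`, `t` the number of
prime divisors of `|d_K|` — the ambiguous classes form a subset of `Cl_K` of cardinality `2^{t−1}`
(tree theorem `Quadratic.card_sq_eq_one_classGroup`, Cox Prop. 3.11/Thm. 3.15; used by
Gross–Zagier 1986 p. 232 in the form "`2^{t−1}` divides `h(D)` by genus theory").
[cite: GrossZagier1986, §I.8, p. 232] -/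
theorem two_pow_le_classNumber {K : Type*} [Field K] [NumberField K]
    (hK : Literature.NumberTheory.EllipticCurves.IsImaginaryQuadratic K) :
    2 ^ ((NumberField.discr K).natAbs.primeFactors.card - 1) ≤ NumberField.classNumber K := by
  rw [← Quadratic.card_sq_eq_one_classGroup hK, NumberField.classNumber, ← Nat.card_eq_fintype_card]
  exact Finite.card_subtype_le _

/-! ### Theorem (8.1) -/

/-- Elementary: for `0 < x ≤ 1/2`, `log (1/(1−x)) ≤ 2x`. [folklore] -/
private theorem log_inv_one_sub_le {x : ℝ} (hx0 : 0 ≤ x) (hx : x ≤ 1 / 2) :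
    Real.log (1 / (1 - x)) ≤ 2 * x := by
  have h1x : 0 < 1 - x := by linarith
  have hlog : Real.log (1 / (1 - x)) ≤ 1 / (1 - x) - 1 := Real.log_le_sub_one_of_pos (by positivity)
  have hb : 1 / (1 - x) - 1 ≤ 2 * x := by
    rw [div_sub_one h1x.ne', div_le_iff₀ h1x]
    nlinarith
  linarith

/-- `3 ≤ |d_K|` for a quadratic field (Hermite–Minkowski, Mathlib `NumberField.abs_discr_gt_two`),
hence `1 < log |d_K|`. [folklore] -/
private theorem one_lt_log_natAbs_discr {K : Type*} [Field K] [NumberField K]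
    (h2 : Module.finrank ℚ K = 2) : 1 < Real.log ((NumberField.discr K).natAbs : ℝ) := by
  have h3 : (3 : ℝ) ≤ ((NumberField.discr K).natAbs : ℝ) := by
    have := NumberField.abs_discr_gt_two (K := K) (by omega)
    have h3' : 3 ≤ (NumberField.discr K).natAbs := by
      have : (2 : ℤ) < ((NumberField.discr K).natAbs : ℤ) := by
        rwa [Int.natCast_natAbs]
      omega
    exact_mod_cast h3'
  have he : Real.exp 1 < 3 := lt_trans Real.exp_one_lt_d9 (by norm_num)
  calc (1 : ℝ) = Real.log (Real.exp 1) := (Real.log_exp 1).symm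
    _ < Real.log 3 := Real.log_lt_log (Real.exp_pos 1) he
    _ ≤ Real.log ((NumberField.discr K).natAbs : ℝ) := Real.log_le_log (by norm_num) h3

/-- **Gross–Zagier 1986, Theorem (8.1), from Oesterlé's Théorème 1** (Invent. Math. 84, p. 232:
"For any `ε > 0` there is an effectively computable constant `κ(ε) > 0` such that
`h(D) > κ(ε)(log |D|)^{1−ε}`", deduced there from Oesterlé's (8.2) "since `2^{t−1}` divides `h(D)`
by genus theory"). Here: assuming the tree fact `Oesterle1985_theoreme1` (`θ(d) log d ≤ C h(−d)`),
for every `ε > 0` there is `κ > 0` (explicit in `C` and `ε`) with `κ (log |d_K|)^{1−ε} < h_K` for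
every imaginary quadratic field `K`. [cite: GrossZagier1986, §I.8 Thm. (8.1), p. 232] -/
theorem classNumber_gt_of_oesterle (h : Oesterle1985_theoreme1) {ε : ℝ} (hε : 0 < ε) :
    ∃ κ : ℝ, 0 < κ ∧ ∀ (K : Type) [Field K] [NumberField K],
      Module.finrank ℚ K = 2 → NumberField.discr K < 0 →
        κ * Real.log ((NumberField.discr K).natAbs : ℝ) ^ (1 - ε) < (NumberField.classNumber K : ℝ) := by
  obtain ⟨C, hC, hOe⟩ := h
  -- the working epsilon and the cut-off `T`
  set ε' : ℝ := min ε (1 / 2) with hε'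
  have hε'0 : 0 < ε' := lt_min hε (by norm_num)
  have hε'h : ε' ≤ 1 / 2 := min_le_right _ _
  have hε'ε : ε' ≤ ε := min_le_left _ _
  have hlog2 : 0 < Real.log 2 := Real.log_pos (by norm_num)
  set T : ℕ := ⌈16 / (ε' * Real.log 2) ^ 2⌉₊ + 16 with hTdef
  have hT16 : 16 ≤ T := by omega
  have hT0 : (0 : ℝ) < T := by exact_mod_cast (show 0 < T by omega)
  -- `√T ≥ 4 / (ε' log 2)` and `√T ≥ 4`
  have hsqT : 4 / (ε' * Real.log 2) ≤ Real.sqrt T := by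
    have hle : 16 / (ε' * Real.log 2) ^ 2 ≤ (T : ℝ) := by
      have := Nat.le_ceil (16 / (ε' * Real.log 2) ^ 2)
      have hT' : (⌈16 / (ε' * Real.log 2) ^ 2⌉₊ : ℝ) ≤ T := by
        rw [hTdef]; push_cast; linarith
      linarith
    have hsq : (4 / (ε' * Real.log 2)) ^ 2 = 16 / (ε' * Real.log 2) ^ 2 := by
      rw [div_pow]; norm_num
    calc 4 / (ε' * Real.log 2) = Real.sqrt ((4 / (ε' * Real.log 2)) ^ 2) :=
          (Real.sqrt_sq (by positivity)).symm
      _ ≤ Real.sqrt T := Real.sqrt_le_sqrt (by rw [hsq]; exact hle)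
  have hsqT4 : 4 ≤ Real.sqrt T := by
    rw [show (4 : ℝ) = Real.sqrt 16 by
      rw [show (16 : ℝ) = 4 ^ 2 by norm_num, Real.sqrt_sq (by norm_num)]]
    exact Real.sqrt_le_sqrt (by exact_mod_cast hT16)
  -- `r = 1 − 2/√T ∈ [1/2, 1)` and `λ = log(1/r)/log 2 ∈ [0, ε']`
  set x : ℝ := 2 / Real.sqrt T with hx
  have hx0 : 0 < x := by positivity
  have hxh : x ≤ 1 / 2 := by
    rw [hx, div_le_iff₀ (by linarith)]; linarith
  set r : ℝ := 1 - x with hr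
  have hr0 : 0 < r := by rw [hr]; linarith
  have hr1 : r ≤ 1 := by rw [hr]; linarith
  set lam : ℝ := Real.log (1 / r) / Real.log 2 with hlam
  have hlam0 : 0 ≤ lam := by
    apply div_nonneg _ hlog2.le
    exact Real.log_nonneg (by rw [le_div_iff₀ hr0]; linarith)
  have hlamε : lam ≤ ε' := by
    -- `log(1/r) ≤ 2x = 4/√T ≤ ε' log 2`
    have h1 : Real.log (1 / r) ≤ 2 * x := log_inv_one_sub_le hx0.le hxh
    have h2 : 2 * x ≤ ε' * Real.log 2 := by
      rw [hx]
      have hsq0 : 0 < Real.sqrt T := by linarith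
      have := hsqT
      rw [div_le_iff₀ (by positivity)] at this
      rw [mul_div_assoc', div_le_iff₀ hsq0]
      linarith
    rw [hlam, div_le_iff₀ hlog2]
    linarith
  -- `2^λ = 1/r`
  have htwo : (2 : ℝ) ^ lam = 1 / r := by
    rw [Real.rpow_def_of_pos (by norm_num : (0 : ℝ) < 2), hlam, mul_div_cancel₀ _ hlog2.ne',
      Real.exp_log (by positivity)]
  -- the constant
  set M : ℝ := C * (T : ℝ) ^ T with hM
  have hM0 : 0 < M := by positivity
  set κ₀ : ℝ := min 1 (1 / M) with hκ₀
  have hκ₀0 : 0 < κ₀ := lt_min one_pos (by positivity)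
  refine ⟨κ₀ / 2, by positivity, ?_⟩
  intro K _ _ h2 hd
  -- notation
  set d : ℕ := (NumberField.discr K).natAbs with hdd
  set hK : ℝ := (NumberField.classNumber K : ℝ) with hhK
  set L : ℝ := Real.log (d : ℝ) with hL
  have hL1 : 1 < L := one_lt_log_natAbs_discr h2
  have hL0 : 0 < L := by linarith
  have hh1 : (1 : ℝ) ≤ hK := by
    rw [hhK]; exact_mod_cast NumberField.classNumber_pos (K := K)
  have hh0 : 0 < hK := by linarith
  -- genus theory: `2^n ≤ h` with `n = #P(d) ≤ t − 1`
  have hIQ : Literature.NumberTheory.EllipticCurves.IsImaginaryQuadratic K :=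
    Literature.NumberTheory.EllipticCurves.isImaginaryQuadratic_iff_discr_neg.mpr ⟨h2, hd⟩
  set n : ℕ := (d.primeFactors.erase (d.primeFactors.sup id)).card with hn
  have h2n : (2 : ℝ) ^ n ≤ hK := by
    have hgen := two_pow_le_classNumber hIQ
    have hle : 2 ^ n ≤ NumberField.classNumber K :=
      le_trans (Nat.pow_le_pow_right (by norm_num) (card_primeFactors_erase_sup_le d)) hgen
    rw [hhK]; exact_mod_cast hle
  -- `r^n · h^λ ≥ 1`
  have hrn : 1 ≤ r ^ n * hK ^ lam := by
    have hpow : ((2 : ℝ) ^ n) ^ lam ≤ hK ^ lam := Real.rpow_le_rpow (by positivity) h2n hlam0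
    have heq : ((2 : ℝ) ^ n) ^ lam = (1 / r) ^ n := by
      rw [← Real.rpow_natCast (2 : ℝ) n, ← Real.rpow_mul (by norm_num), mul_comm,
        Real.rpow_mul (by norm_num), htwo, Real.rpow_natCast]
    rw [heq] at hpow
    calc (1 : ℝ) = r ^ n * (1 / r) ^ n := by
          rw [← mul_pow, mul_one_div_cancel hr0.ne', one_pow]
      _ ≤ r ^ n * hK ^ lam := mul_le_mul_of_nonneg_left hpow (pow_nonneg hr0.le _)
  -- Oesterlé: `θ(d) · L ≤ C h`, and `θ(d) ≥ T^{−T} r^n`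
  have hOeK := hOe K h2 hd
  have hθ : (1 / (T : ℝ)) ^ T * r ^ n ≤ oesterleTheta d := by
    have := oesterleTheta_ge d hT16
    simpa [hr, hx, hn] using this
  have hθ0 : 0 < oesterleTheta d := oesterleTheta_pos d
  -- hence `L ≤ M · h · h^λ`
  have hTT : (1 / (T : ℝ)) ^ T * (T : ℝ) ^ T = 1 := by
    rw [← mul_pow, one_div_mul_cancel hT0.ne', one_pow]
  have hmain : L ≤ M * (hK * hK ^ lam) := by
    -- `L ≤ L · (θ T^T h^λ · r^{-n}...)`: multiply Oesterlé by `T^T h^λ` and use `hrn`, `hθ`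
    have hA : L * ((1 / (T : ℝ)) ^ T * r ^ n) ≤ L * oesterleTheta d :=
      mul_le_mul_of_nonneg_left hθ hL0.le
    have hB : L * oesterleTheta d ≤ C * hK := by
      have := hOeK; rw [mul_comm] at this; simpa [hdd, hL, hhK] using this
    have hC' : L * ((1 / (T : ℝ)) ^ T * r ^ n) * ((T : ℝ) ^ T * hK ^ lam) ≤
        C * hK * ((T : ℝ) ^ T * hK ^ lam) :=
      mul_le_mul_of_nonneg_right (le_trans hA hB) (by positivity)
    have hD : L ≤ L * ((1 / (T : ℝ)) ^ T * r ^ n) * ((T : ℝ) ^ T * hK ^ lam) := by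
      have : L * ((1 / (T : ℝ)) ^ T * r ^ n) * ((T : ℝ) ^ T * hK ^ lam) =
          L * (r ^ n * hK ^ lam) * ((1 / (T : ℝ)) ^ T * (T : ℝ) ^ T) := by ring
      rw [this, hTT, mul_one]
      calc L = L * 1 := (mul_one L).symm
        _ ≤ L * (r ^ n * hK ^ lam) := mul_le_mul_of_nonneg_left hrn hL0.le
    calc L ≤ _ := hD
      _ ≤ C * hK * ((T : ℝ) ^ T * hK ^ lam) := hC'
      _ = M * (hK * hK ^ lam) := by rw [hM]; ring
  -- `h^{1+λ}` and its `(1+λ)`-th root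
  have hpow1 : hK * hK ^ lam = hK ^ (1 + lam) := by
    rw [Real.rpow_add hh0, Real.rpow_one]
  set a : ℝ := 1 / (1 + lam) with ha
  have ha0 : 0 < a := by positivity
  have ha1 : a ≤ 1 := by rw [ha, div_le_one (by linarith)]; linarith
  have haε : 1 - ε ≤ a := by
    have : 1 - lam ≤ a := by
      rw [ha, le_div_iff₀ (by linarith)]; nlinarith
    linarith
  have hquot : L / M ≤ hK ^ (1 + lam) := by
    rw [div_le_iff₀ hM0, ← hpow1]; linarith [hmain]
  have hroot : (L / M) ^ a ≤ hK := by
    have := Real.rpow_le_rpow (by positivity) hquot ha0.le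
    rwa [← Real.rpow_mul hh0.le, show (1 + lam) * a = 1 by
      rw [ha, mul_one_div_cancel (by linarith)], Real.rpow_one] at this
  -- `(L/M)^a = L^a · (1/M)^a ≥ L^{1−ε} · κ₀`
  have hsplit : (L / M) ^ a = L ^ a * (1 / M) ^ a := by
    rw [div_eq_mul_one_div, Real.mul_rpow hL0.le (by positivity)]
  have hLa : L ^ (1 - ε) ≤ L ^ a := Real.rpow_le_rpow_of_exponent_le hL1.le haε
  have hMa : κ₀ ≤ (1 / M) ^ a := by
    by_cases hM1 : 1 ≤ 1 / M
    · exact le_trans (min_le_left _ _) (Real.one_le_rpow hM1 ha0.le)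
    · have hM1' : 1 / M < 1 := not_le.mp hM1
      calc κ₀ ≤ 1 / M := min_le_right _ _
        _ = (1 / M) ^ (1 : ℝ) := (Real.rpow_one _).symm
        _ ≤ (1 / M) ^ a := Real.rpow_le_rpow_of_exponent_ge (by positivity) hM1'.le ha1
  have hfinal : κ₀ * L ^ (1 - ε) ≤ hK := by
    calc κ₀ * L ^ (1 - ε) ≤ (1 / M) ^ a * L ^ a :=
          mul_le_mul hMa hLa (Real.rpow_nonneg hL0.le _) (Real.rpow_nonneg (by positivity) _)
      _ = (L / M) ^ a := by rw [hsplit, mul_comm]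
      _ ≤ hK := hroot
  have hLpos : 0 < L ^ (1 - ε) := Real.rpow_pos_of_pos hL0 _
  have : κ₀ / 2 * L ^ (1 - ε) < κ₀ * L ^ (1 - ε) := by
    apply mul_lt_mul_of_pos_right _ hLpos; linarith
  simpa [hL, hdd, hhK] using lt_of_lt_of_le this hfinal

/-! ### Oesterlé's genus-theory corollaries (exp. 631, p. 311) -/

/-- **Genus theory, divisibility form:** `2^{t−1} ∣ h_K` for an imaginary quadratic field `K`
(`t = ω(|d_K|)`): the ambiguous classes `{C : C² = 1}` are the `2`-torsion SUBGROUP of `Cl_K`,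
of order `2^{t−1}` (tree theorem `Quadratic.card_sq_eq_one_classGroup`), and Lagrange. Oesterlé
1985, p. 311: "le cardinal de `P(d)` est inférieur à la valuation `2`-adique de `h`".
[cite: Oesterle1985, p. 311] -/
theorem two_pow_dvd_classNumber {K : Type*} [Field K] [NumberField K]
    (hK : Literature.NumberTheory.EllipticCurves.IsImaginaryQuadratic K) :
    2 ^ ((NumberField.discr K).natAbs.primeFactors.card - 1) ∣ NumberField.classNumber K := by
  rw [← Quadratic.card_sq_eq_one_classGroup hK, NumberField.classNumber, ← Nat.card_eq_fintype_card]
  have hcard : Nat.card {c : ClassGroup (𝓞 K) // c ^ 2 = 1} =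
      Nat.card (powMonoidHom 2 : ClassGroup (𝓞 K) →* ClassGroup (𝓞 K)).ker :=
    Nat.card_congr (Equiv.subtypeEquivRight fun c => by simp [MonoidHom.mem_ker, powMonoidHom_apply])
  rw [hcard]
  exact Subgroup.card_subgroup_dvd_card _

/-- Each factor of `θ(d)` is `≥ 1/4`: `1 − [2√p]/(p+1) ≥ 1/4` for every prime `p`, with equality at
`p = 3` (Oesterlé 1985, p. 311: the values `1/3, 1/4, 1/3, 3/8` for `p = 2, 3, 5, 7` and `≥ 1/2` for
`p ≥ 11`). [cite: Oesterle1985, p. 311] -/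
theorem quarter_le_thetaFactor {p : ℕ} (hp : p.Prime) :
    1 / 4 ≤ 1 - (Nat.sqrt (4 * p) : ℝ) / ((p : ℝ) + 1) := by
  have hpos : (0 : ℝ) < (p : ℝ) + 1 := by positivity
  by_cases h5 : 5 ≤ p
  · -- `[2√p] ≤ 2√p` and `8√p ≤ 3(p+1)` for `p ≥ 5`
    have hp0 : (0 : ℝ) < p := by exact_mod_cast hp.pos
    have hs : (Nat.sqrt (4 * p) : ℝ) ≤ 2 * Real.sqrt p := by
      have hsq' : ((Nat.sqrt (4 * p) : ℕ) : ℝ) ^ 2 ≤ 4 * (p : ℝ) := by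
        exact_mod_cast (by simpa [pow_two] using Nat.sqrt_le' (4 * p) : (Nat.sqrt (4 * p)) ^ 2 ≤ 4 * p)
      have h2 : (2 * Real.sqrt p) ^ 2 = 4 * (p : ℝ) := by
        rw [mul_pow, Real.sq_sqrt hp0.le]; norm_num
      have hnn : (0 : ℝ) ≤ 2 * Real.sqrt p := by positivity
      nlinarith [sq_nonneg ((Nat.sqrt (4 * p) : ℝ) - 2 * Real.sqrt p), hsq', h2, hnn,
        Nat.cast_nonneg (α := ℝ) (Nat.sqrt (4 * p))]
    have h5' : (5 : ℝ) ≤ p := by exact_mod_cast h5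
    have hpp : Real.sqrt p * Real.sqrt p = p := Real.mul_self_sqrt hp0.le
    have hsq0 : 0 ≤ Real.sqrt p := Real.sqrt_nonneg _
    -- `8 √p ≤ 3 (p + 1)` since `(3√p − 8)·… ≥ 0`: from `9p² − 46p + 9 ≥ 0`
    have h8 : 8 * Real.sqrt p ≤ 3 * ((p : ℝ) + 1) := by
      nlinarith [sq_nonneg (3 * Real.sqrt p - 8), hpp, h5', hsq0,
        mul_nonneg (sub_nonneg.mpr h5') hsq0]
    rw [le_sub_comm, div_le_iff₀ hpos]
    nlinarith [hs, h8]
  · -- `p ∈ {2, 3}`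
    have h2 : 2 ≤ p := hp.two_le
    have hlt : p < 5 := not_le.mp h5
    interval_cases p
    · -- p = 2: `Nat.sqrt 8 = 2`
      have : Nat.sqrt (4 * 2) = 2 := by
        have hl : 2 ≤ Nat.sqrt (4 * 2) := Nat.le_sqrt.mpr (by norm_num)
        have hu : Nat.sqrt (4 * 2) < 3 := Nat.sqrt_lt.mpr (by norm_num)
        omega
      rw [this]; norm_num
    · -- p = 3: `Nat.sqrt 12 = 3`
      have : Nat.sqrt (4 * 3) = 3 := by
        have hl : 3 ≤ Nat.sqrt (4 * 3) := Nat.le_sqrt.mpr (by norm_num)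
        have hu : Nat.sqrt (4 * 3) < 4 := Nat.sqrt_lt.mpr (by norm_num)
        omega
      rw [this]; norm_num
    · exact absurd hp (by norm_num)

/-- **Oesterlé 1985, corollaries of Théorème 1 (p. 311), first two lines:** with the constant `C`
of Théorème 1, for an imaginary quadratic field of discriminant `−d`:
`h(−d)` odd `⇒ log d ≤ C h(−d)`, and `h(−d) ≡ 2 (mod 4) ⇒ log d ≤ 4C h(−d)`. Printed proof: "le
cardinal de `P(d)` est inférieur à la valuation `2`-adique de `h`" (genus theory,
`two_pow_dvd_classNumber`) and the factor values `≥ 1/4` (`quarter_le_thetaFactor`). Derived here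
from the tree fact `Oesterle1985_theoreme1`. [cite: Oesterle1985, p. 311] -/
theorem log_le_of_oesterle (h : Oesterle1985_theoreme1) :
    ∃ C : ℝ, 0 < C ∧ ∀ (K : Type) [Field K] [NumberField K],
      Module.finrank ℚ K = 2 → NumberField.discr K < 0 →
        (Odd (NumberField.classNumber K) →
          Real.log ((NumberField.discr K).natAbs : ℝ) ≤ C * (NumberField.classNumber K : ℝ)) ∧
        (NumberField.classNumber K % 4 = 2 →
          Real.log ((NumberField.discr K).natAbs : ℝ) ≤ 4 * C * (NumberField.classNumber K : ℝ)) := by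
  obtain ⟨C, hC, hOe⟩ := h
  refine ⟨C, hC, fun K _ _ h2 hd => ?_⟩
  have hIQ : Literature.NumberTheory.EllipticCurves.IsImaginaryQuadratic K :=
    Literature.NumberTheory.EllipticCurves.isImaginaryQuadratic_iff_discr_neg.mpr ⟨h2, hd⟩
  have hgen := two_pow_dvd_classNumber hIQ
  have hOeK := hOe K h2 hd
  set d : ℕ := (NumberField.discr K).natAbs with hdd
  have hL0 : 0 ≤ Real.log (d : ℝ) := Real.log_natCast_nonneg d
  constructor
  · -- `h` odd ⇒ `t ≤ 1` ⇒ `θ(d) = 1`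
    intro hodd
    have ht : d.primeFactors.card ≤ 1 := by
      by_contra hlt
      have h2dvd : 2 ∣ 2 ^ (d.primeFactors.card - 1) := dvd_pow_self 2 (by omega)
      exact (Nat.not_even_iff_odd.mpr hodd) (even_iff_two_dvd.mpr (h2dvd.trans hgen))
    have hθ : oesterleTheta d = 1 := oesterleTheta_of_card_primeFactors_le_one ht
    rw [hθ, one_mul] at hOeK
    exact hOeK
  · -- `h ≡ 2 (mod 4)` ⇒ `t ≤ 2` ⇒ `#P(d) ≤ 1` ⇒ `θ(d) ≥ 1/4`
    intro hmod
    have ht : d.primeFactors.card ≤ 2 := by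
      by_contra hlt
      have h4dvd : 4 ∣ 2 ^ (d.primeFactors.card - 1) := by
        have : (4 : ℕ) = 2 ^ 2 := by norm_num
        rw [this]; exact Nat.pow_dvd_pow 2 (by omega)
      have := Nat.mod_eq_zero_of_dvd (h4dvd.trans hgen)
      omega
    have hcard : (d.primeFactors.erase (d.primeFactors.sup id)).card ≤ 1 :=
      le_trans (card_primeFactors_erase_sup_le d) (by omega)
    have hθ : 1 / 4 ≤ oesterleTheta d := by
      unfold oesterleTheta
      rcases Nat.le_one_iff_eq_zero_or_eq_one.mp hcard with h0 | h1
      · rw [Finset.card_eq_zero.mp h0, Finset.prod_empty]; norm_num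
      · obtain ⟨q, hq⟩ := Finset.card_eq_one.mp h1
        rw [hq, Finset.prod_singleton]
        have hqmem : q ∈ d.primeFactors.erase (d.primeFactors.sup id) := by rw [hq]; simp
        exact quarter_le_thetaFactor (Nat.prime_of_mem_primeFactors (Finset.mem_of_mem_erase hqmem))
    have : 1 / 4 * Real.log (d : ℝ) ≤ C * (NumberField.classNumber K : ℝ) :=
      le_trans (mul_le_mul_of_nonneg_right hθ hL0) hOeK
    linarith

/-! ### Oesterlé's corollaries, lines three and four (`12 C`, `36 C`) and the general `2`-adic form -/

/-- Each factor of `θ(d)` at a prime `p ≠ 3` is `≥ 1/3`: `1 − [2√p]/(p+1) ≥ 1/3`, with equality at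
`p = 2, 5` (Oesterlé 1985, p. 311: the values `1/3, 1/4, 1/3, 3/8` at `p = 2, 3, 5, 7` and `≥ 1/2`
for `p ≥ 11`; for `p ≥ 7` we use `3·[2√p] ≤ 2(p+1)`, i.e. `p² − 7p + 1 ≥ 0`).
[cite: Oesterle1985, p. 311] -/
theorem third_le_thetaFactor {p : ℕ} (hp : p.Prime) (h3 : p ≠ 3) :
    1 / 3 ≤ 1 - (Nat.sqrt (4 * p) : ℝ) / ((p : ℝ) + 1) := by
  have hpos : (0 : ℝ) < (p : ℝ) + 1 := by positivity
  by_cases h7 : 7 ≤ p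
  · -- `3 [2√p] ≤ 2(p + 1)` for `p ≥ 7`
    have h7' : (7 : ℝ) ≤ p := by exact_mod_cast h7
    have hs' : ((Nat.sqrt (4 * p) : ℕ) : ℝ) ^ 2 ≤ 4 * (p : ℝ) := by
      exact_mod_cast (by simpa [pow_two] using Nat.sqrt_le' (4 * p) : (Nat.sqrt (4 * p)) ^ 2 ≤ 4 * p)
    have hs0 : (0 : ℝ) ≤ (Nat.sqrt (4 * p) : ℝ) := Nat.cast_nonneg _
    have h32 : 3 * (Nat.sqrt (4 * p) : ℝ) ≤ 2 * ((p : ℝ) + 1) := by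
      by_contra hlt
      rw [not_le] at hlt
      have h9 : (2 * ((p : ℝ) + 1)) ^ 2 < (3 * (Nat.sqrt (4 * p) : ℝ)) ^ 2 :=
        pow_lt_pow_left₀ hlt (by positivity) two_ne_zero
      nlinarith [h9, hs', h7']
    rw [le_sub_comm, div_le_iff₀ hpos]
    linarith
  · have h2 : 2 ≤ p := hp.two_le
    have hlt : p < 7 := not_le.mp h7
    interval_cases p
    · -- p = 2: `Nat.sqrt 8 = 2`
      have : Nat.sqrt (4 * 2) = 2 := by
        have hl : 2 ≤ Nat.sqrt (4 * 2) := Nat.le_sqrt.mpr (by norm_num)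
        have hu : Nat.sqrt (4 * 2) < 3 := Nat.sqrt_lt.mpr (by norm_num)
        omega
      rw [this]; norm_num
    · exact absurd rfl h3
    · exact absurd hp (by norm_num)
    · -- p = 5: `Nat.sqrt 20 = 4`
      have : Nat.sqrt (4 * 5) = 4 := by
        have hl : 4 ≤ Nat.sqrt (4 * 5) := Nat.le_sqrt.mpr (by norm_num)
        have hu : Nat.sqrt (4 * 5) < 5 := Nat.sqrt_lt.mpr (by norm_num)
        omega
      rw [this]; norm_num
    · exact absurd hp (by norm_num)

/-- **`θ(d) ≥ (3/4)·3^{−(t−1)}`** (`t = ω(d)`): `θ(d)` is a product over at most `t − 1` distinct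
primes of factors `≥ 1/3`, except possibly the single factor `1/4` at `p = 3` (Oesterlé 1985,
p. 311, factor values). [cite: Oesterle1985, p. 311] -/
theorem oesterleTheta_ge_two_adic (d : ℕ) :
    3 / 4 * (1 / 3) ^ (d.primeFactors.card - 1) ≤ oesterleTheta d := by
  unfold oesterleTheta
  set S := d.primeFactors.erase (d.primeFactors.sup id) with hS
  have hSprime : ∀ p ∈ S, p.Prime := fun p hp =>
    Nat.prime_of_mem_primeFactors (Finset.mem_of_mem_erase hp)
  -- over `S.erase 3` every factor is `≥ 1/3`
  have hprod3 : ∀ T : Finset ℕ, T ⊆ S → 3 ∉ T →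
      (1 / 3 : ℝ) ^ T.card ≤ ∏ p ∈ T, (1 - (Nat.sqrt (4 * p) : ℝ) / ((p : ℝ) + 1)) := by
    intro T hT h3
    rw [← Finset.prod_const]
    refine Finset.prod_le_prod (fun _ _ => by norm_num) fun p hp => ?_
    exact third_le_thetaFactor (hSprime p (hT hp)) (fun h => h3 (h ▸ hp))
  have hcardS : S.card ≤ d.primeFactors.card - 1 := card_primeFactors_erase_sup_le d
  have hpow : (1 / 3 : ℝ) ^ (d.primeFactors.card - 1) ≤ (1 / 3) ^ S.card :=
    pow_le_pow_of_le_one (by norm_num) (by norm_num) hcardS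
  by_cases h3 : 3 ∈ S
  · -- split off the factor at `p = 3`, which is `≥ 1/4`
    rw [← Finset.mul_prod_erase S _ h3]
    have hq : (1 / 4 : ℝ) ≤ 1 - (Nat.sqrt (4 * 3) : ℝ) / (((3 : ℕ) : ℝ) + 1) :=
      quarter_le_thetaFactor Nat.prime_three
    have hrest := hprod3 (S.erase 3) (Finset.erase_subset 3 S) (Finset.notMem_erase 3 S)
    have hcard : (S.erase 3).card = S.card - 1 := Finset.card_erase_of_mem h3
    have hS1 : 1 ≤ S.card := Finset.card_pos.mpr ⟨3, h3⟩
    have hrest0 : (0 : ℝ) ≤ (1 / 3 : ℝ) ^ (S.erase 3).card := by positivity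
    calc 3 / 4 * (1 / 3 : ℝ) ^ (d.primeFactors.card - 1)
        ≤ 3 / 4 * (1 / 3) ^ S.card := by gcongr
      _ = 1 / 4 * (1 / 3) ^ (S.erase 3).card := by
          rw [hcard]
          obtain ⟨m, hm⟩ : ∃ m, S.card = m + 1 := ⟨S.card - 1, by omega⟩
          rw [hm, pow_succ]; simp; ring
      _ ≤ (1 - (Nat.sqrt (4 * 3) : ℝ) / (((3 : ℕ) : ℝ) + 1)) *
            ∏ p ∈ S.erase 3, (1 - (Nat.sqrt (4 * p) : ℝ) / ((p : ℝ) + 1)) :=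
          mul_le_mul hq hrest hrest0 (by linarith)
  · have hrest := hprod3 S le_rfl h3
    have h0 : (0 : ℝ) ≤ (1 / 3 : ℝ) ^ S.card := by positivity
    linarith

/-- **Oesterlé 1985, corollaries of Théorème 1 (p. 311), lines three and four, and the general
`2`-adic form**, "avec la même constante `C`": for an imaginary quadratic field of discriminant `−d`
and class number `h`, if `2^{k+1} ∤ h` then `#P(d) ≤ k` (genus theory: "le cardinal de `P(d)` est
inférieur à la valuation `2`-adique de `h`", `two_pow_dvd_classNumber`), so `θ(d) ≥ (3/4)3^{−k}`
(`oesterleTheta_ge_two_adic`) and `log d ≤ (4/3)·3^k·C·h`; in particular (as printed)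
`h ≡ 4 (mod 8) ⇒ log d ≤ 12 C h` and `h ≡ 8 (mod 16) ⇒ log d ≤ 36 C h` ("etc."). Derived from the
tree fact `Oesterle1985_theoreme1`; the first two printed lines are `log_le_of_oesterle`.
[cite: Oesterle1985, p. 311] -/
theorem log_le_of_oesterle_two_adic (h : Oesterle1985_theoreme1) :
    ∃ C : ℝ, 0 < C ∧ ∀ (K : Type) [Field K] [NumberField K],
      Module.finrank ℚ K = 2 → NumberField.discr K < 0 →
        (∀ k : ℕ, ¬ 2 ^ (k + 1) ∣ NumberField.classNumber K →
          Real.log ((NumberField.discr K).natAbs : ℝ) ≤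
            4 / 3 * 3 ^ k * C * (NumberField.classNumber K : ℝ)) ∧
        (NumberField.classNumber K % 8 = 4 →
          Real.log ((NumberField.discr K).natAbs : ℝ) ≤ 12 * C * (NumberField.classNumber K : ℝ)) ∧
        (NumberField.classNumber K % 16 = 8 →
          Real.log ((NumberField.discr K).natAbs : ℝ) ≤ 36 * C * (NumberField.classNumber K : ℝ)) := by
  obtain ⟨C, hC, hOe⟩ := h
  refine ⟨C, hC, fun K _ _ h2 hd => ?_⟩
  have hIQ : Literature.NumberTheory.EllipticCurves.IsImaginaryQuadratic K :=
    Literature.NumberTheory.EllipticCurves.isImaginaryQuadratic_iff_discr_neg.mpr ⟨h2, hd⟩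
  have hgen := two_pow_dvd_classNumber hIQ
  have hOeK := hOe K h2 hd
  set d : ℕ := (NumberField.discr K).natAbs with hdd
  have hL0 : 0 ≤ Real.log (d : ℝ) := Real.log_natCast_nonneg d
  -- the general `2`-adic statement
  have hmain : ∀ k : ℕ, ¬ 2 ^ (k + 1) ∣ NumberField.classNumber K →
      Real.log (d : ℝ) ≤ 4 / 3 * 3 ^ k * C * (NumberField.classNumber K : ℝ) := by
    intro k hk
    -- `t − 1 ≤ k`
    have ht : d.primeFactors.card - 1 ≤ k := by
      by_contra hlt
      exact hk ((Nat.pow_dvd_pow 2 (by omega)).trans hgen)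
    have hθ : 3 / 4 * (1 / 3 : ℝ) ^ k ≤ oesterleTheta d :=
      le_trans (mul_le_mul_of_nonneg_left (pow_le_pow_of_le_one (by norm_num) (by norm_num) ht)
        (by norm_num)) (oesterleTheta_ge_two_adic d)
    have hle : 3 / 4 * (1 / 3 : ℝ) ^ k * Real.log (d : ℝ) ≤ C * (NumberField.classNumber K : ℝ) :=
      le_trans (mul_le_mul_of_nonneg_right hθ hL0) hOeK
    have e : (4 : ℝ) / 3 * 3 ^ k * (3 / 4 * (1 / 3) ^ k * Real.log (d : ℝ)) = Real.log (d : ℝ) := by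
      rw [one_div_pow]; field_simp
    calc Real.log (d : ℝ) = 4 / 3 * 3 ^ k * (3 / 4 * (1 / 3) ^ k * Real.log (d : ℝ)) := e.symm
      _ ≤ 4 / 3 * 3 ^ k * (C * (NumberField.classNumber K : ℝ)) := by gcongr
      _ = 4 / 3 * 3 ^ k * C * (NumberField.classNumber K : ℝ) := by ring
  refine ⟨hmain, fun hmod => ?_, fun hmod => ?_⟩
  · -- `h ≡ 4 (mod 8)`: `8 ∤ h`, `k = 2`, `(4/3)·9 = 12`
    have h8 : ¬ 2 ^ (2 + 1) ∣ NumberField.classNumber K := by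
      intro hdvd
      have := Nat.mod_eq_zero_of_dvd hdvd
      norm_num at this
      omega
    have := hmain 2 h8
    norm_num at this
    linarith
  · -- `h ≡ 8 (mod 16)`: `16 ∤ h`, `k = 3`, `(4/3)·27 = 36`
    have h16 : ¬ 2 ^ (3 + 1) ∣ NumberField.classNumber K := by
      intro hdvd
      have := Nat.mod_eq_zero_of_dvd hdvd
      norm_num at this
      omega
    have := hmain 3 h16
    norm_num at this
    linarith

end Literature.NumberTheory.QuadraticFields

end
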